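import Mathlib
import Literature.MathematicalPhysics.QuantumFieldTheory.Dimock2011to13.FluctuationCovarianceIdentity
import Literature.MathematicalPhysics.QuantumFieldTheory.Dimock2011to13.CovarianceSquareRoot

/-!
# Dimock, *The renormalization group according to Balaban* II–III: the MULTI-REGION free flow — the minimizer
# `φ_{k,Ω}` and its completed square (II, Thm 2.1), the Schur complement `Δ_{k,Ω}` (II, Lemma 2.2), the
# multi-region fluctuation-covariance identity (II, App. C (z4)) and the joint minimizer (III, App. A) — PROVED
# as finite-dimensional linear algebra

**Citation header (reproduction of PUBLISHED work; template of the Balaban lattice Yang–Mills cell).**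
J. Dimock, *The renormalization group according to Balaban. II. Large fields*, J. Math. Phys. **54** (2013) 092301
(= arXiv:1212.5562v2) [Dimock2013BalabanII]: §2.2 "free flow" — Theorem 2.1 (`\label{sonnyboy}`, TeX L594–614, proof
L617–655), Lemma 2.2 (`\label{rain}`, L672–681, proof L683–707) — and Appendix C "another identity", Lemma (`\label{z4}`,
L6576–6681).  J. Dimock, *The
renormalization group according to Balaban. III. Convergence*, Ann. Henri Poincaré **15** (2014) 2133–2175
(= arXiv:1304.0705v1) [Dimock2013BalabanIII]: Appendix A "minimizers", Lemma 18 ((star)/(star2), TeX L2513–2600; the 18th `lem` of the source).  TeX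
line numbers refer to the arXiv sources held by the cell (`inputs/files/dimock/src/1212.5562/1212.5562.tex`, 7217 lines;
`inputs/files/dimock/src/1304.0705/1304.0705.tex`).  Printed numbering by the concordance of `HOME/TEMPLATE.md` §9.

**What the papers print (verbatim).**  [Dimock2013BalabanII] L588–590: *"Here φ_Ω is the restriction to Ω,
[−Δ]_Ω ≡ 1_Ω[−Δ]1_Ω is the Laplacian with Dirichlet boundary conditions, and [−Δ]_{Ω,Ωᶜ} ≡ 1_Ω[−Δ]1_{Ωᶜ}."*  Theorem 2.1
(L594–614): *"Starting with the free density after k steps the density has the form ρ_{k,Ω}(φ_{Ω₁ᶜ}, Φ_{k,Ω}) = Z_{k,Ω}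
exp(−½‖𝐚^{1/2}(Φ_{k,Ω} − Q_{k,Ω}φ)‖²_{Ω₁} − ½⟨φ, (−Δ + μ̄_k)φ⟩) at φ_{Ω₁} = φ_{k,Ω} … φ_{k,Ω} = φ_{k,Ω}(φ_{Ω₁ᶜ}, Φ_{k,Ω})
= G_{k,Ω}(Q_{k,Ω}ᵀ𝐚Φ_{k,Ω} + [Δ]_{Ω₁,Ω₁ᶜ}φ_{Ω₁ᶜ})  (unknown)  where  G_{k,Ω} = [−Δ + μ̄_k + Q_{k,Ω}ᵀ𝐚Q_{k,Ω}]_{Ω₁}^{−1}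
(sinsin)"*; proof L634–655: *"We do the integral by minimizing the exponent in φ_{Ω₁}. Taking the derivative in this
variable and setting it equal to zero gives the variational equation [−Δ + μ̄_k + Q_{k,Ω}ᵀ𝐚Q_{k,Ω}]_{Ω₁}φ_{Ω₁} =
Q_{k,Ω}ᵀ𝐚Φ_{k,Ω} + [Δ]_{Ω₁,Ω₁ᶜ}φ_{Ω₁ᶜ} and the solution is φ_{Ω₁} = φ_{k,Ω} … write φ_{Ω₁} = φ_{k,Ω} + 𝒵 … The term
with no 𝒵's comes outside the integral … The term linear in 𝒵 vanishes. The term quadratic in 𝒵 is −½⟨𝒵, [−Δ + μ̄_k +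
Q_{k,Ω}ᵀ𝐚Q_{k,Ω}]_{Ω₁}𝒵⟩."*  (sun) L666–669: *"S_k(Ω₁, Φ_{k,Ω}, φ) = ½‖𝐚^{1/2}(Φ_{k,Ω} − Q_{k,Ω}φ)‖²_{Ω₁} + ½⟨φ,
[−Δ + μ̄_k]_{Ω₁}φ⟩"*.  Lemma 2.2 (L672–681): *"S_k(Ω₁, Φ_{k,Ω}, φ_{k,Ω}) = ½⟨Φ_{k,Ω}, Δ_{k,Ω}Φ_{k,Ω}⟩ + ½⟨φ_{Ω₁ᶜ},
[Δ]_{Ω₁ᶜ,Ω₁}G_{k,Ω}[Δ]_{Ω₁,Ω₁ᶜ}φ_{Ω₁ᶜ}⟩  (rain)  where  Δ_{k,Ω} = 𝐚 − 𝐚Q_{k,Ω}G_{k,Ω}Q_{k,Ω}ᵀ𝐚"*, proof L683–707 via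
(sun2): *"S_k(…) = ½‖𝐚^{1/2}Φ_{k,Ω}‖² − ⟨Q_{k,Ω}ᵀ𝐚Φ_{k,Ω}, φ_{k,Ω}⟩ − [sic] ½⟨φ_{k,Ω}, [−Δ + μ̄_k + Q_{k,Ω}ᵀ𝐚Q_{k,Ω}]_{Ω₁}
φ_{k,Ω}⟩. Insert the expression for φ_{k,Ω} and obtain (ping)"*.  App. C (L6578–6601): *"We seek an alternate
expression for C_{k,Ω⁺,r} = [Δ_{k,Ω} + (a/L²)QᵀQ + r]^{−1}_{Ω_{k+1}} where as in the text Ω⁺ = (Ω, Ω_{k+1}) = (Ω_1, …,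
Ω_k, Ω_{k+1}).  Lemma.
C_{k,Ω⁺,r} = [A_{k,r} + a_k²A_{k,r}Q_kG_{k,Ω⁺,r}Q_kᵀA_{k,r}]_{Ω_{k+1}}  (z4)  where  A_{k,r} = (1/(a_k+r))(I − QᵀQ) +
(1/(a_k + aL^{−2} + r))QᵀQ,  B_{k,r} = (r/(a_k+r))(I − QᵀQ) + ((aL^{−2}+r)/(a_k + aL^{−2} + r))QᵀQ,  G_{k,Ω⁺,r} = [−Δ + μ̄_k
+ [Q_{k,Ω}ᵀ𝐚Q_{k,Ω}]_{Ω_{k+1}ᶜ} + a_k[Q_kᵀB_{k,r}Q_k]_{Ω_{k+1}}]_{Ω₁}^{−1}"*; proof L6604–6681 (*"Specializing to Φ_{k,Ω} =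
(0, Φ) with Φ on Ω_{k+1} this says exp(−½⟨Φ, Δ_{k,Ω}Φ⟩) = const∫exp(−(a_k/2)‖Φ − Q_kφ‖²_{Ω_{k+1}} − ½‖𝐚^{1/2}Q_{k,Ω}
φ‖²_{Ω_{k+1}ᶜ} − ½⟨φ, (−Δ + μ̄_k)φ⟩)dφ … Here we used (a_k + r + aL^{−2}Q_kᵀQ_k)^{−1} = A_{k,r}"* ⟦sic: `QᵀQ`⟧ *"which
follows since Q_kᵀQ_k is a projection … Here we have used the identity a_k²A_{k,r} − a_k = … = −a_kB_{k,r}"*).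
[Dimock2013BalabanIII] App. A (L2535–2548, L2551–2570): *"Given a new region Ω_{k+1} ⊂ Ω_k we want to find the minimizer
of S(Ω₁, Φ_{k,Ω}, φ_{k,Ω}) in Φ_{k,Ω_{k+1}} with all other variables fixed … This is the same as the minimizer of
S(Ω₁, Φ_{k,Ω}, φ) = S(Ω₁, Φ_{k,δΩ⁺}, Φ_{k,Ω_{k+1}}, φ) in both Φ_{k,Ω_{k+1}} and φ_{Ω₁}.  The solution depends on the
Green's function G_{k,δΩ⁺} = [−Δ + μ̄_k + Q_{k,δΩ⁺}ᵀ𝐚Q_{k,δΩ⁺}]_{Ω₁}^{−1} … Lemma. 1. Given Φ_{k,δΩ⁺} The unique minimum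
of S(Ω₁, Φ_{k,Ω}, φ) in Φ_{k,Ω_{k+1}} and φ_{Ω₁} comes at φ_{Ω₁} = φ_{k,δΩ⁺} = … = G_{k,δΩ⁺}(Q_{k,δΩ⁺}ᵀ𝐚Φ_{k,δΩ⁺} +
[Δ]_{Ω₁,Ω₁ᶜ}φ_{Ω₁ᶜ})  (star)  and at Φ_{k,Ω_{k+1}} = Ψ_{k,Ω_{k+1}}(δΩ⁺) = [Q_kφ_{k,δΩ⁺}]_{Ω_{k+1}}.  2. We have the
identity φ_{k,δΩ⁺} = φ_{k,Ω}(φ_{Ω₁ᶜ}, Φ_{k,δΩ⁺}, Ψ_{k,Ω_{k+1}}(δΩ⁺))  (star2)"*; proof L2579–2600 (*"Substituting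
Φ_{k,Ω_{k+1}} = Q_kφ into the second equation and canceling a term a_kQ_kᵀQ_kφ on each side …"*); remark L2574–2576:
*"This is only useful for μ̄_k has a substantial size and so can take the place of the missing averaging operator in
Ω_{k+1} in G_{k,δΩ⁺}."*

**What is reproduced here (kernel-checked, zero `sorry`).**  Everything above is finite-dimensional linear algebra once
the lattices are finite index types.  CARRIER: `κ` = the sites of `Ω₁` in the fine lattice (home of `φ_{Ω₁}` and of
`D := [−Δ + μ̄_k]_{Ω₁}`, ANY real symmetric positive-definite matrix); `m` = the index set of the multiscale variable
`Φ_{k,Ω} = (Φ_{1,δΩ₁}, …, Φ_{k,Ω_k})` with weight `𝐚 : Matrix m m ℝ` (print: the diagonal `a_jL^{−(k−j)}`; here ANY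
symmetric positive-semidefinite, positive-definite where said); `Q_{k,Ω} : Matrix m κ ℝ` ARBITRARY; the boundary datum
enters only through the source `src := [Δ]_{Ω₁,Ω₁ᶜ}φ_{Ω₁ᶜ} : κ → ℝ`, ARBITRARY.  For App. C / App. A the variable splits
as `m = ι ⊕ τ` (`ι` = `Ω^{(k)}_{k+1}`, `τ` = the layers `δΩ_j`), `𝐚 = a_k ⊕ 𝐚_τ` (`weightO`), `Q_{k,Ω} = rows(Q_k, Q_τ)`
(`rowsO`), and `E := [Q_{k,Ω}ᵀ𝐚Q_{k,Ω}]_{Ω_{k+1}ᶜ} = Q_τᵀ𝐚_τQ_τ` (`restE`).  PROVED: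
* §2 **THEOREM 2.1** — the bracket `D + Q_{k,Ω}ᵀ𝐚Q_{k,Ω}` is positive definite (`gInvO_posDef`), `φ_{k,Ω}` (unknown)
  solves the variational equation (`variational_eq`) and is its only solution (`eq_minimizer_of_variational_eq`), and the
  exponent COMPLETES THE SQUARE: `energy (φ_{k,Ω} + 𝒵) = energy φ_{k,Ω} + ½⟨𝒵, (D + Qᵀ𝐚Q)𝒵⟩` (`energy_minimizer_add` —
  *"The term linear in 𝒵 vanishes"*), hence `φ_{k,Ω}` is the unique minimizer (`energy_minimizer_lt`);
* §3 **LEMMA 2.2 (rain)** `action_minimizer`: `S_k(Ω₁, Φ, φ_{k,Ω}) = ½⟨Φ, Δ_{k,Ω}Φ⟩ + ½⟨src, G_{k,Ω} src⟩`, with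
  `Δ_{k,Ω} = 𝐚 − 𝐚QGQᵀ𝐚` symmetric (`DeltakO_transpose`) and POSITIVE DEFINITE when `𝐚 > 0` (`DeltakO_posDef`, via
  `dot_DeltakO_mulVec`: `⟨Φ, Δ_{k,Ω}Φ⟩ = ‖𝐚^{1/2}(Φ − Qφ₀)‖² + ⟨φ₀, Dφ₀⟩` at the source-free minimizer `φ₀`);
* §4 the SPECIALIZATION of App. C (*"Φ_{k,Ω} = (0, Φ) with Φ on Ω_{k+1}"*): `Q_{k,Ω}ᵀ𝐚Q_{k,Ω} = a_kQ_kᵀQ_k + E`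
  (`rowsO_weight_rowsO`), `G_{k,Ω} = G_k[D + E]` (`GkO_block`), `[Δ_{k,Ω}]_{Ω_{k+1}} = Δ_k[D + E]` (`DeltakO_toBlocks₁₁` — the
  single-region closed form of [Dimock2013] (spiffy) = `FluctuationCovarianceIdentity.Deltak` with `D ↦ D + E`), and the
  restricted quadratic form (`sumElim_zero_dot_mulVec`);
* §5 **LEMMA (z4)** `CkOr_eq`: `C_{k,Ω⁺,r} = A_{k,r} + a_k²A_{k,r}Q_kG_{k,Ω⁺,r}Q_kᵀA_{k,r}` for `D > 0`, `𝐚_τ ≥ 0`, `QQᵀ =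
  I`, `a_k > 0`, `aL = a/L² ≥ 0`, `r ≥ 0` — `FluctuationCovarianceIdentity.Ckr_eq` at `D + E` (`CkOr_eq_Ckr`,
  `GkOr_eq_Gkr`), with `C_{k,Ω⁺,r}` a genuine inverse (`CkOr_mul_eq_one`);
* §6 **[Dimock2013BalabanIII] APP. A LEMMA 18**: the block functional separates (`energy_block`), its joint minimum over
  `(Φ_{k,Ω_{k+1}}, φ_{Ω₁})` is attained exactly at `(Ψ, φ_{k,δΩ⁺}) = (Q_kφ_{k,δΩ⁺}, G_{k,δΩ⁺}(Q_τᵀ𝐚_τΦ_τ + src))`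
  (`energy_block_joint_min`, `energy_block_joint_min_eq_iff` — (star)), and (star2) `minimizer_star2`:
  `φ_{k,δΩ⁺} = φ_{k,Ω}(φ_{Ω₁ᶜ}, Φ_{k,δΩ⁺}, Ψ)`.

**Deviations (declared).**  (i) finite index types and abstract matrices: `[−Δ + μ̄_k]_{Ω₁}` is any positive-definite
`D`, `𝐚` any symmetric positive-(semi)definite weight, `Q_{k,Ω}` any matrix — the printed objects are instances; (ii) the
boundary coupling `[Δ]_{Ω₁,Ω₁ᶜ}φ_{Ω₁ᶜ}` is carried as an arbitrary source vector `src` (so (rain)'s second term reads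
`½⟨src, G_{k,Ω}src⟩`; the print's `[Δ]_{Ω₁ᶜ,Ω₁} = [Δ]_{Ω₁,Ω₁ᶜ}ᵀ`); (iii) the `Ω_{k+1}`-block is placed FIRST in the sum
type `ι ⊕ τ` (the print lists it last); (iv) in (z4) the outer restriction `[·]_{Ω_{k+1}}` is built into the carrier: the
next averaging `Q : Matrix σ ι ℝ` acts on `Ω^{(k)}_{k+1}` and only `QQᵀ = I` is assumed; `aL` stands for `a/L²`.

**What is NOT claimed.**  The Gaussian integrals themselves (normalizations `Z_{k,Ω}`, `𝒩_{k,Ω}`), Theorem 2.2 / Lemmas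
2.3–2.7 of [Dimock2013BalabanII] §2 (bounds on `φ_{k,Ω}`, `G_{k,Ω}`, random-walk expansions), the bound L3500 on
`[Δ_{k,Ω} + aL^{−2}QᵀQ]_{Ω_{k+1}}`, anything of B1–B16 (TEMPLATE.md §4.2 maps Thm 2.1 / Lemma 2.2 to B6 §A (2.5)–(2.12)
and B9 Thms 3.1–3.3, grade T; §4.5 maps [Dimock2013BalabanIII] App. A to B11 §D Props 4–5, grade P — linear vs. non-linear).
Finite-dimensional linear algebra only; `[folklore]` items are private helpers.  NOT summit progress; NOT a statement
about any Bałaban paper; NOT continuum; NOT Clay.  Unit `b2b-balaban-template` gen 29 (journal CLAIM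
D2-MULTIREGION-FREEFLOW-KERNEL).

**Version.**  v1.0.1 — DOCFIX fold of the outside-lineage XREAD VERDICT (cell journal l.2219, GAPS C-beta-an3-48:
ok CONSISTENT 4/4, DOCFIX 3 optional, INFO 4): the App. C quotation above completed with L6582's tail
*"= (Ω_1, …, Ω_k, Ω_{k+1})"*; TeX locators corrected — App. C proof ends at L6681 (not L6689), `restE` L6625 (the
`‖𝐚^{1/2}Q_{k,Ω}φ‖²_{Ω^c_{k+1}}` line), the split `a_kQ_kᵀQ_k + [Q_{k,Ω}ᵀ𝐚Q_{k,Ω}]_{Ω^c_{k+1}}` at L6657/L6661 inside the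
display L6652–6672 (`rowsO_weight_rowsO`, `gInvO_block`, `GkO_block`), (unknown) = L603–609 (display L605–609); record
only (reader's I1): (tony3) L624 prints `μ̄_0`, a misprint for `μ̄_k` ((tony2) L585, L637) — the `energy` docstring writes
`μ̄_k`.  Docstring-only: every declaration, statement and proof is byte-identical to v1 (p197774).
-/

namespace Literature.MathematicalPhysics.QuantumFieldTheory.Dimock2011to13.MultiRegionFreeFlow

open Matrix
open scoped Matrix
open Literature.MathematicalPhysics.QuantumFieldTheory.Dimock2011to13.FluctuationCovarianceIdentity
open Literature.MathematicalPhysics.QuantumFieldTheory.Dimock2011to13.CovarianceSquareRoot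

variable {κ m : Type*} [Fintype κ] [Fintype m] [DecidableEq κ] [DecidableEq m]

/-! ## §1 The objects of [Dimock2013BalabanII] §2.2, as printed -/

/-- the bracket of `G_{k,Ω}`: `[−Δ + μ̄_k + Q_{k,Ω}ᵀ 𝐚 Q_{k,Ω}]_{Ω₁}` with `D := [−Δ + μ̄_k]_{Ω₁}`.
[cite: Dimock2013BalabanII, Thm 2.1 (sinsin) L610–613 (arXiv:1212.5562v2 TeX)] -/
def gInvO (D : Matrix κ κ ℝ) (a : Matrix m m ℝ) (Qm : Matrix m κ ℝ) : Matrix κ κ ℝ := D + Qmᵀ * a * Qm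

/-- `G_{k,Ω} = [−Δ + μ̄_k + Q_{k,Ω}ᵀ 𝐚 Q_{k,Ω}]_{Ω₁}^{−1}`. [cite: Dimock2013BalabanII, Thm 2.1 (sinsin) L610–613
(arXiv:1212.5562v2 TeX)] -/
noncomputable def GkO (D : Matrix κ κ ℝ) (a : Matrix m m ℝ) (Qm : Matrix m κ ℝ) : Matrix κ κ ℝ := (gInvO D a Qm)⁻¹

/-- the minimizer `φ_{k,Ω}(φ_{Ω₁ᶜ}, Φ_{k,Ω}) = G_{k,Ω}(Q_{k,Ω}ᵀ 𝐚 Φ_{k,Ω} + [Δ]_{Ω₁,Ω₁ᶜ} φ_{Ω₁ᶜ})`, the boundary datum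
carried as the source `src = [Δ]_{Ω₁,Ω₁ᶜ} φ_{Ω₁ᶜ}`. [cite: Dimock2013BalabanII, Thm 2.1 (unknown) L603–609
(arXiv:1212.5562v2 TeX)] -/
noncomputable def minimizer (D : Matrix κ κ ℝ) (a : Matrix m m ℝ) (Qm : Matrix m κ ℝ) (Φ : m → ℝ) (src : κ → ℝ) :
    κ → ℝ :=
  GkO D a Qm *ᵥ (Qmᵀ *ᵥ (a *ᵥ Φ) + src)

/-- the action `S_k(Ω₁, Φ_{k,Ω}, φ) = ½‖𝐚^{1/2}(Φ_{k,Ω} − Q_{k,Ω}φ)‖²_{Ω₁} + ½⟨φ, [−Δ + μ̄_k]_{Ω₁}φ⟩`.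
[cite: Dimock2013BalabanII, §2.2 (sun) L666–669 (arXiv:1212.5562v2 TeX)] -/
noncomputable def action (D : Matrix κ κ ℝ) (a : Matrix m m ℝ) (Qm : Matrix m κ ℝ) (Φ : m → ℝ) (φ : κ → ℝ) : ℝ :=
  (1 / 2) * ((Φ - Qm *ᵥ φ) ⬝ᵥ (a *ᵥ (Φ - Qm *ᵥ φ))) + (1 / 2) * (φ ⬝ᵥ (D *ᵥ φ))

/-- minus the exponent of (tony3) as a function of `φ_{Ω₁}`:
`½‖𝐚^{1/2}(Φ − Qφ)‖² + ⟨φ, [−Δ]_{Ω₁,Ω₁ᶜ}φ_{Ω₁ᶜ}⟩ + ½⟨φ, [−Δ + μ̄_k]_{Ω₁}φ⟩ = S_k(Ω₁, Φ, φ) − ⟨φ, src⟩` with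
`src = [Δ]_{Ω₁,Ω₁ᶜ}φ_{Ω₁ᶜ}` (the constant factor in `φ_{Ω₁ᶜ}` alone is dropped).
[cite: Dimock2013BalabanII, Thm 2.1 proof (tony3) L617–628 (arXiv:1212.5562v2 TeX)] -/
noncomputable def energy (D : Matrix κ κ ℝ) (a : Matrix m m ℝ) (Qm : Matrix m κ ℝ) (Φ : m → ℝ) (src φ : κ → ℝ) : ℝ :=
  action D a Qm Φ φ - φ ⬝ᵥ src

/-- `Δ_{k,Ω} = 𝐚 − 𝐚 Q_{k,Ω} G_{k,Ω} Q_{k,Ω}ᵀ 𝐚`. [cite: Dimock2013BalabanII, Lemma 2.2 L678–680 (arXiv:1212.5562v2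
TeX)] -/
noncomputable def DeltakO (D : Matrix κ κ ℝ) (a : Matrix m m ℝ) (Qm : Matrix m κ ℝ) : Matrix m m ℝ :=
  a - a * Qm * GkO D a Qm * Qmᵀ * a

/-! ### [folklore] helpers on symmetric matrices and dot products -/

section Helpers

variable {n : Type*}

omit [DecidableEq κ] in
/-- for a symmetric matrix, `⟨x, My⟩ = ⟨y, Mx⟩`. [folklore] -/
private theorem dot_mulVec_comm {M : Matrix κ κ ℝ} (hM : Mᵀ = M) (x y : κ → ℝ) :
    x ⬝ᵥ (M *ᵥ y) = y ⬝ᵥ (M *ᵥ x) := by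
  rw [dotProduct_mulVec, ← mulVec_transpose, hM, dotProduct_comm]

omit [DecidableEq κ] [DecidableEq m] in
/-- `⟨Z, Qᵀ v⟩ = ⟨QZ, v⟩`. [folklore] -/
private theorem dot_transpose_mulVec (Qm : Matrix m κ ℝ) (Z : κ → ℝ) (v : m → ℝ) :
    Z ⬝ᵥ (Qmᵀ *ᵥ v) = (Qm *ᵥ Z) ⬝ᵥ v := by
  rw [dotProduct_mulVec, vecMul_transpose]

omit [DecidableEq κ] [DecidableEq m] in
/-- `⟨Z, (Qᵀ 𝐚 Q) v⟩ = ⟨QZ, 𝐚(Qv)⟩`. [folklore] -/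
private theorem dot_sandwich_mulVec (a : Matrix m m ℝ) (Qm : Matrix m κ ℝ) (Z v : κ → ℝ) :
    Z ⬝ᵥ ((Qmᵀ * a * Qm) *ᵥ v) = (Qm *ᵥ Z) ⬝ᵥ (a *ᵥ (Qm *ᵥ v)) := by
  rw [← mulVec_mulVec, ← mulVec_mulVec, dot_transpose_mulVec]

/-- a real positive-definite matrix is symmetric. [folklore] -/
private theorem transpose_eq_of_posDef {M : Matrix n n ℝ} (hM : M.PosDef) : Mᵀ = M := by
  have h := hM.isHermitian
  rwa [IsHermitian, conjTranspose_eq_transpose_of_trivial] at h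

/-- a real positive-semidefinite matrix is symmetric. [folklore] -/
private theorem transpose_eq_of_posSemidef {M : Matrix n n ℝ} (hM : M.PosSemidef) : Mᵀ = M := by
  have h := hM.isHermitian
  rwa [IsHermitian, conjTranspose_eq_transpose_of_trivial] at h

end Helpers

/-! ## §2 Theorem 2.1 (sonnyboy): the minimizer and the completed square -/

section Sonnyboy

variable {D : Matrix κ κ ℝ} {a : Matrix m m ℝ} {Qm : Matrix m κ ℝ}

omit [DecidableEq κ] [DecidableEq m] in
/-- `Q_{k,Ω}ᵀ 𝐚 Q_{k,Ω} ≥ 0` for `𝐚 ≥ 0`. [folklore] -/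
private theorem sandwich_posSemidef (ha : a.PosSemidef) (Qm : Matrix m κ ℝ) : (Qmᵀ * a * Qm).PosSemidef := by
  have h := ha.conjTranspose_mul_mul_same Qm
  rwa [conjTranspose_eq_transpose_of_trivial] at h

omit [DecidableEq κ] [DecidableEq m] in
/-- **the bracket `[−Δ + μ̄_k + Q_{k,Ω}ᵀ𝐚Q_{k,Ω}]_{Ω₁}` is positive definite** (`D > 0`, `𝐚 ≥ 0`), so `G_{k,Ω}` exists
and the Gaussian integral over `𝒵` of the printed proof converges. [cite: Dimock2013BalabanII, Thm 2.1 (sinsin) L610–613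
and L648–655 (arXiv:1212.5562v2 TeX)] -/
theorem gInvO_posDef (hD : D.PosDef) (ha : a.PosSemidef) : (gInvO D a Qm).PosDef :=
  hD.add_posSemidef (sandwich_posSemidef ha Qm)

omit [DecidableEq m] in
/-- `[−Δ + μ̄_k + Qᵀ𝐚Q]_{Ω₁} · G_{k,Ω} = 1`. [cite: Dimock2013BalabanII, Thm 2.1 (sinsin) L610–613 (arXiv:1212.5562v2
TeX)] -/
theorem gInvO_mul_GkO (hD : D.PosDef) (ha : a.PosSemidef) : gInvO D a Qm * GkO D a Qm = 1 := by
  unfold GkO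
  exact Matrix.mul_nonsing_inv _ ((Matrix.isUnit_iff_isUnit_det _).mp (gInvO_posDef hD ha).isUnit)

omit [DecidableEq m] in
/-- `G_{k,Ω} · [−Δ + μ̄_k + Qᵀ𝐚Q]_{Ω₁} = 1`. [cite: Dimock2013BalabanII, Thm 2.1 (sinsin) L610–613 (arXiv:1212.5562v2
TeX)] -/
theorem GkO_mul_gInvO (hD : D.PosDef) (ha : a.PosSemidef) : GkO D a Qm * gInvO D a Qm = 1 := by
  unfold GkO
  exact Matrix.nonsing_inv_mul _ ((Matrix.isUnit_iff_isUnit_det _).mp (gInvO_posDef hD ha).isUnit)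

omit [DecidableEq m] in
/-- `G_{k,Ω}` is symmetric. [folklore] -/
private theorem GkO_transpose (hD : D.PosDef) (ha : a.PosSemidef) : (GkO D a Qm)ᵀ = GkO D a Qm := by
  have hsym : (gInvO D a Qm)ᵀ = gInvO D a Qm := by
    have h := (gInvO_posDef (Qm := Qm) hD ha).isHermitian
    rwa [IsHermitian, conjTranspose_eq_transpose_of_trivial] at h
  unfold GkO
  rw [transpose_nonsing_inv, hsym]

omit [DecidableEq m] in
/-- **THE VARIATIONAL EQUATION** `[−Δ + μ̄_k + Q_{k,Ω}ᵀ𝐚Q_{k,Ω}]_{Ω₁} φ_{k,Ω} = Q_{k,Ω}ᵀ𝐚Φ_{k,Ω} + [Δ]_{Ω₁,Ω₁ᶜ}φ_{Ω₁ᶜ}`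
holds for (unknown). [cite: Dimock2013BalabanII, Thm 2.1 proof L634–641 (arXiv:1212.5562v2 TeX)] -/
theorem variational_eq (hD : D.PosDef) (ha : a.PosSemidef) (Φ : m → ℝ) (src : κ → ℝ) :
    gInvO D a Qm *ᵥ minimizer D a Qm Φ src = Qmᵀ *ᵥ (a *ᵥ Φ) + src := by
  unfold minimizer
  rw [mulVec_mulVec, gInvO_mul_GkO hD ha, one_mulVec]

omit [DecidableEq m] in
/-- … and (unknown) is its ONLY solution (*"and the solution is φ_{Ω₁} = φ_{k,Ω}"*). [cite: Dimock2013BalabanII, Thm 2.1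
proof L641 (arXiv:1212.5562v2 TeX)] -/
theorem eq_minimizer_of_variational_eq (hD : D.PosDef) (ha : a.PosSemidef) {Φ : m → ℝ} {src φ : κ → ℝ}
    (h : gInvO D a Qm *ᵥ φ = Qmᵀ *ᵥ (a *ᵥ Φ) + src) : φ = minimizer D a Qm Φ src := by
  unfold minimizer
  rw [← h, mulVec_mulVec, GkO_mul_gInvO hD ha, one_mulVec]

omit [DecidableEq κ] [DecidableEq m] in
/-- the quadratic expansion of the exponent about ANY `φ` (symmetric `D`, `𝐚`):
`E(φ + 𝒵) = E(φ) + ⟨𝒵, (D + Qᵀ𝐚Q)φ − Qᵀ𝐚Φ − src⟩ + ½⟨𝒵, (D + Qᵀ𝐚Q)𝒵⟩`. [folklore] -/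
private theorem energy_add (hDs : Dᵀ = D) (has : aᵀ = a) (Φ : m → ℝ) (src φ Z : κ → ℝ) :
    energy D a Qm Φ src (φ + Z)
      = energy D a Qm Φ src φ + Z ⬝ᵥ (gInvO D a Qm *ᵥ φ - (Qmᵀ *ᵥ (a *ᵥ Φ) + src))
        + (1 / 2) * (Z ⬝ᵥ (gInvO D a Qm *ᵥ Z)) := by
  -- scalar atoms
  set u : m → ℝ := Φ - Qm *ᵥ φ with hu
  set w : m → ℝ := Qm *ᵥ Z with hw
  have hsplit : Φ - Qm *ᵥ (φ + Z) = u - w := by rw [hu, hw, mulVec_add]; abel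
  -- symmetric pairings
  have hwu : u ⬝ᵥ (a *ᵥ w) = w ⬝ᵥ (a *ᵥ u) := dot_mulVec_comm has u w
  have hZφ : φ ⬝ᵥ (D *ᵥ Z) = Z ⬝ᵥ (D *ᵥ φ) := dot_mulVec_comm hDs φ Z
  -- expand the left side
  have hL : energy D a Qm Φ src (φ + Z)
      = (1 / 2) * (u ⬝ᵥ (a *ᵥ u)) - w ⬝ᵥ (a *ᵥ u) + (1 / 2) * (w ⬝ᵥ (a *ᵥ w))
        + (1 / 2) * (φ ⬝ᵥ (D *ᵥ φ)) + Z ⬝ᵥ (D *ᵥ φ) + (1 / 2) * (Z ⬝ᵥ (D *ᵥ Z))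
        - φ ⬝ᵥ src - Z ⬝ᵥ src := by
    unfold energy action
    rw [hsplit, mulVec_sub, sub_dotProduct, dotProduct_sub, dotProduct_sub, hwu, mulVec_add, add_dotProduct,
      dotProduct_add, dotProduct_add, hZφ, add_dotProduct]
    ring
  -- expand the right side
  have hR1 : Z ⬝ᵥ (gInvO D a Qm *ᵥ φ - (Qmᵀ *ᵥ (a *ᵥ Φ) + src))
      = Z ⬝ᵥ (D *ᵥ φ) - w ⬝ᵥ (a *ᵥ u) - Z ⬝ᵥ src := by
    unfold gInvO
    rw [dotProduct_sub, dotProduct_add, add_mulVec, dotProduct_add, dot_sandwich_mulVec, dot_transpose_mulVec,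
      ← hw, hu, mulVec_sub, dotProduct_sub]
    ring
  have hR2 : Z ⬝ᵥ (gInvO D a Qm *ᵥ Z) = Z ⬝ᵥ (D *ᵥ Z) + w ⬝ᵥ (a *ᵥ w) := by
    unfold gInvO
    rw [add_mulVec, dotProduct_add, dot_sandwich_mulVec, ← hw]
  have hE : energy D a Qm Φ src φ = (1 / 2) * (u ⬝ᵥ (a *ᵥ u)) + (1 / 2) * (φ ⬝ᵥ (D *ᵥ φ)) - φ ⬝ᵥ src := by
    unfold energy action
    rw [hu]
  rw [hL, hR1, hR2, hE]
  ring

omit [DecidableEq m] in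
/-- **THEOREM 2.1, THE COMPLETED SQUARE**: writing `φ_{Ω₁} = φ_{k,Ω} + 𝒵`, *"The term with no 𝒵's comes outside the
integral … The term linear in 𝒵 vanishes. The term quadratic in 𝒵 is −½⟨𝒵, [−Δ + μ̄_k + Q_{k,Ω}ᵀ𝐚Q_{k,Ω}]_{Ω₁}𝒵⟩"*:
`E(φ_{k,Ω} + 𝒵) = E(φ_{k,Ω}) + ½⟨𝒵, (D + Qᵀ𝐚Q)𝒵⟩`. [cite: Dimock2013BalabanII, Thm 2.1 proof L645–655
(arXiv:1212.5562v2 TeX)] -/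
theorem energy_minimizer_add (hD : D.PosDef) (ha : a.PosSemidef) (Φ : m → ℝ) (src Z : κ → ℝ) :
    energy D a Qm Φ src (minimizer D a Qm Φ src + Z)
      = energy D a Qm Φ src (minimizer D a Qm Φ src) + (1 / 2) * (Z ⬝ᵥ (gInvO D a Qm *ᵥ Z)) := by
  rw [energy_add (transpose_eq_of_posDef hD) (transpose_eq_of_posSemidef ha), variational_eq hD ha, sub_self,
    dotProduct_zero, add_zero]

omit [DecidableEq m] in
/-- the exponent at any `φ` in terms of the minimizer: `E(φ) = E(φ_{k,Ω}) + ½⟨φ − φ_{k,Ω}, (D + Qᵀ𝐚Q)(φ − φ_{k,Ω})⟩`.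
[cite: Dimock2013BalabanII, Thm 2.1 proof L645–655 (arXiv:1212.5562v2 TeX)] -/
theorem energy_eq_minimizer_add (hD : D.PosDef) (ha : a.PosSemidef) (Φ : m → ℝ) (src φ : κ → ℝ) :
    energy D a Qm Φ src φ
      = energy D a Qm Φ src (minimizer D a Qm Φ src)
        + (1 / 2) * ((φ - minimizer D a Qm Φ src) ⬝ᵥ (gInvO D a Qm *ᵥ (φ - minimizer D a Qm Φ src))) := by
  have h := energy_minimizer_add (Qm := Qm) hD ha Φ src (φ - minimizer D a Qm Φ src)
  rwa [add_sub_cancel] at h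

omit [DecidableEq m] in
/-- **`φ_{k,Ω}` IS THE UNIQUE MINIMIZER** of the exponent (*"We do the integral by minimizing the exponent in
φ_{Ω₁}"*): `E(φ_{k,Ω}) < E(φ)` for every other `φ`. [cite: Dimock2013BalabanII, Thm 2.1 proof L634–649
(arXiv:1212.5562v2 TeX)] -/
theorem energy_minimizer_lt (hD : D.PosDef) (ha : a.PosSemidef) (Φ : m → ℝ) (src : κ → ℝ) {φ : κ → ℝ}
    (hφ : φ ≠ minimizer D a Qm Φ src) :
    energy D a Qm Φ src (minimizer D a Qm Φ src) < energy D a Qm Φ src φ := by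
  rw [energy_eq_minimizer_add hD ha Φ src φ]
  have hpos := (gInvO_posDef (Qm := Qm) hD ha).dotProduct_mulVec_pos (sub_ne_zero.mpr hφ)
  rw [star_trivial] at hpos
  linarith

omit [DecidableEq m] in
/-- … and `E(φ_{k,Ω}) ≤ E(φ)` for all `φ`. [cite: Dimock2013BalabanII, Thm 2.1 proof L634–649 (arXiv:1212.5562v2 TeX)] -/
theorem energy_minimizer_le (hD : D.PosDef) (ha : a.PosSemidef) (Φ : m → ℝ) (src φ : κ → ℝ) :
    energy D a Qm Φ src (minimizer D a Qm Φ src) ≤ energy D a Qm Φ src φ := by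
  by_cases hφ : φ = minimizer D a Qm Φ src
  · rw [hφ]
  · exact (energy_minimizer_lt hD ha Φ src hφ).le

end Sonnyboy

/-! ## §3 Lemma 2.2 (rain): the action at the minimizer and `Δ_{k,Ω}` -/

section Rain

variable {D : Matrix κ κ ℝ} {a : Matrix m m ℝ} {Qm : Matrix m κ ℝ}

omit [DecidableEq κ] [DecidableEq m] in
/-- (sun2): `S_k(Ω₁, Φ, φ) = ½‖𝐚^{1/2}Φ‖² − ⟨Qᵀ𝐚Φ, φ⟩ + ½⟨φ, (D + Qᵀ𝐚Q)φ⟩` for ANY `φ` (symmetric `𝐚`; the print's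
minus sign in front of the last term is a misprint corrected by its own next display (ping)).
[cite: Dimock2013BalabanII, Lemma 2.2 proof (sun2) L683–693 (arXiv:1212.5562v2 TeX)] -/
theorem action_eq_sun2 (has : aᵀ = a) (Φ : m → ℝ) (φ : κ → ℝ) :
    action D a Qm Φ φ
      = (1 / 2) * (Φ ⬝ᵥ (a *ᵥ Φ)) - (Qmᵀ *ᵥ (a *ᵥ Φ)) ⬝ᵥ φ + (1 / 2) * (φ ⬝ᵥ (gInvO D a Qm *ᵥ φ)) := by
  unfold action gInvO
  have hsym : Φ ⬝ᵥ (a *ᵥ (Qm *ᵥ φ)) = (Qm *ᵥ φ) ⬝ᵥ (a *ᵥ Φ) := dot_mulVec_comm has Φ (Qm *ᵥ φ)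
  have hT : (Qmᵀ *ᵥ (a *ᵥ Φ)) ⬝ᵥ φ = (Qm *ᵥ φ) ⬝ᵥ (a *ᵥ Φ) := by
    rw [dotProduct_comm, dot_transpose_mulVec]
  rw [mulVec_sub, sub_dotProduct, dotProduct_sub, dotProduct_sub, hsym, add_mulVec, dotProduct_add,
    dot_sandwich_mulVec, hT]
  ring

omit [DecidableEq m] in
/-- **LEMMA 2.2 (rain)**: `S_k(Ω₁, Φ_{k,Ω}, φ_{k,Ω}) = ½⟨Φ_{k,Ω}, Δ_{k,Ω}Φ_{k,Ω}⟩ + ½⟨src, G_{k,Ω} src⟩` with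
`src = [Δ]_{Ω₁,Ω₁ᶜ}φ_{Ω₁ᶜ}` (so the second term is the printed `½⟨φ_{Ω₁ᶜ}, [Δ]_{Ω₁ᶜ,Ω₁}G_{k,Ω}[Δ]_{Ω₁,Ω₁ᶜ}φ_{Ω₁ᶜ}⟩`).
Proof as printed: (sun2), insert (unknown), the cross terms cancel by the symmetry of `G_{k,Ω}` (ping).
[cite: Dimock2013BalabanII, Lemma 2.2 (rain) L672–681, proof L683–707 (arXiv:1212.5562v2 TeX)] -/
theorem action_minimizer (hD : D.PosDef) (ha : a.PosSemidef) (Φ : m → ℝ) (src : κ → ℝ) :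
    action D a Qm Φ (minimizer D a Qm Φ src)
      = (1 / 2) * (Φ ⬝ᵥ (DeltakO D a Qm *ᵥ Φ)) + (1 / 2) * (src ⬝ᵥ (GkO D a Qm *ᵥ src)) := by
  have has := transpose_eq_of_posSemidef ha
  have hGs : (GkO D a Qm)ᵀ = GkO D a Qm := GkO_transpose hD ha
  -- (sun2), and the variational equation for the last pairing: ½⟨φ*, G⁻¹φ*⟩ = ½⟨φ*, u + src⟩
  rw [action_eq_sun2 has, variational_eq hD ha]
  unfold minimizer
  set u : κ → ℝ := Qmᵀ *ᵥ (a *ᵥ Φ) with hu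
  set G := GkO D a Qm with hG
  -- the left side of (rain): ⟨Φ, Δ_{k,Ω}Φ⟩ = ⟨Φ, 𝐚Φ⟩ − ⟨u, G u⟩  (u = Qᵀ𝐚Φ, 𝐚 symmetric)
  have hΔ : Φ ⬝ᵥ (DeltakO D a Qm *ᵥ Φ) = Φ ⬝ᵥ (a *ᵥ Φ) - u ⬝ᵥ (G *ᵥ u) := by
    unfold DeltakO
    rw [sub_mulVec, dotProduct_sub, ← hG, ← mulVec_mulVec, ← mulVec_mulVec, ← mulVec_mulVec, ← mulVec_mulVec,
      ← hu, dot_mulVec_comm has Φ (Qm *ᵥ (G *ᵥ u)), ← dot_transpose_mulVec, ← hu, dotProduct_comm (G *ᵥ u) u]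
  -- insert φ* = G(u + src) (ping); the cross terms cancel by the symmetry of G
  have hy : (G *ᵥ u) ⬝ᵥ src = u ⬝ᵥ (G *ᵥ src) := by rw [dotProduct_comm, dot_mulVec_comm hGs]
  have hz : (G *ᵥ u) ⬝ᵥ u = u ⬝ᵥ (G *ᵥ u) := dotProduct_comm _ _
  have hs : (G *ᵥ src) ⬝ᵥ src = src ⬝ᵥ (G *ᵥ src) := dotProduct_comm _ _
  have hx : (G *ᵥ src) ⬝ᵥ u = u ⬝ᵥ (G *ᵥ src) := dotProduct_comm _ _
  rw [hΔ, mulVec_add, dotProduct_add, add_dotProduct, dotProduct_add, dotProduct_add, hy, hz, hs, hx]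
  ring

omit [DecidableEq m] in
/-- `Δ_{k,Ω}` is symmetric. [cite: Dimock2013BalabanII, Lemma 2.2 L678–680 (arXiv:1212.5562v2 TeX)] -/
theorem DeltakO_transpose (hD : D.PosDef) (ha : a.PosSemidef) : (DeltakO D a Qm)ᵀ = DeltakO D a Qm := by
  have has := transpose_eq_of_posSemidef ha
  unfold DeltakO
  rw [transpose_sub, has, transpose_mul, transpose_mul, transpose_mul, transpose_mul, transpose_transpose, has,
    GkO_transpose hD ha]
  simp only [Matrix.mul_assoc]

omit [DecidableEq m] in
/-- the quadratic form of `Δ_{k,Ω}` at the source-free minimizer `φ₀ = G_{k,Ω}Q_{k,Ω}ᵀ𝐚Φ`: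
`⟨Φ, Δ_{k,Ω}Φ⟩ = ‖𝐚^{1/2}(Φ − Q_{k,Ω}φ₀)‖² + ⟨φ₀, Dφ₀⟩` ((rain) at `φ_{Ω₁ᶜ} = 0`, doubled).
[cite: Dimock2013BalabanII, Lemma 2.2 (rain) L672–681 (arXiv:1212.5562v2 TeX)] -/
theorem dot_DeltakO_mulVec (hD : D.PosDef) (ha : a.PosSemidef) (Φ : m → ℝ) :
    Φ ⬝ᵥ (DeltakO D a Qm *ᵥ Φ)
      = (Φ - Qm *ᵥ minimizer D a Qm Φ 0) ⬝ᵥ (a *ᵥ (Φ - Qm *ᵥ minimizer D a Qm Φ 0))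
        + minimizer D a Qm Φ 0 ⬝ᵥ (D *ᵥ minimizer D a Qm Φ 0) := by
  have h := action_minimizer (Qm := Qm) hD ha Φ 0
  rw [zero_dotProduct, mul_zero, add_zero] at h
  unfold action at h
  linarith

omit [DecidableEq m] in
/-- **`Δ_{k,Ω}` IS POSITIVE DEFINITE** when `𝐚 > 0` and `D > 0` (so `exp(−½⟨Φ, Δ_{k,Ω}Φ⟩)` is a normalizable Gaussian
in `Φ_{k,Ω}`). [cite: Dimock2013BalabanII, Lemma 2.2 (rain) L672–681 (arXiv:1212.5562v2 TeX)] -/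
theorem DeltakO_posDef (hD : D.PosDef) (ha : a.PosDef) : (DeltakO D a Qm).PosDef := by
  have hH : (DeltakO D a Qm).IsHermitian := by
    rw [IsHermitian, conjTranspose_eq_transpose_of_trivial]
    exact DeltakO_transpose hD ha.posSemidef
  refine PosDef.of_dotProduct_mulVec_pos hH fun x hx => ?_
  rw [star_trivial, dot_DeltakO_mulVec hD ha.posSemidef]
  set φ : κ → ℝ := minimizer D a Qm x 0
  have h1 : 0 ≤ (x - Qm *ᵥ φ) ⬝ᵥ (a *ᵥ (x - Qm *ᵥ φ)) := by
    have := ha.posSemidef.dotProduct_mulVec_nonneg (x - Qm *ᵥ φ)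
    rwa [star_trivial] at this
  have h2 : 0 ≤ φ ⬝ᵥ (D *ᵥ φ) := by
    have := hD.posSemidef.dotProduct_mulVec_nonneg φ
    rwa [star_trivial] at this
  by_contra hneg
  push Not at hneg
  have h2' : φ ⬝ᵥ (D *ᵥ φ) = 0 := by linarith
  have hφ : φ = 0 := by
    by_contra hφ
    have := hD.dotProduct_mulVec_pos hφ
    rw [star_trivial] at this
    linarith
  have h1' : (x - Qm *ᵥ φ) ⬝ᵥ (a *ᵥ (x - Qm *ᵥ φ)) = 0 := by linarith
  rw [hφ, mulVec_zero, sub_zero] at h1'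
  have := ha.dotProduct_mulVec_pos hx
  rw [star_trivial] at this
  linarith

end Rain

/-! ## §4 The specialization of App. C: `Φ_{k,Ω} = (0, Φ)` with `Φ` on `Ω_{k+1}` -/

section Block

variable {ι τ : Type*} [Fintype ι] [Fintype τ] [DecidableEq ι]

/-- the weight `𝐚 = (a^{(k)}_1, …, a^{(k)}_k)` split along `m = Ω^{(k)}_{k+1} ⊕ (the rest)`: the scalar `a_k` on the
`Ω_{k+1}`-component (the `(a_k/2)‖Φ − Q_kφ‖²_{Ω_{k+1}}` of (gumdrop2)) and a weight `𝐚_τ` on the layers.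
[cite: Dimock2013BalabanII, §2.1 L473–481 and App. C (gumdrop2) L6620–6628 (arXiv:1212.5562v2 TeX)] -/
def weightO (ak : ℝ) (aτ : Matrix τ τ ℝ) : Matrix (ι ⊕ τ) (ι ⊕ τ) ℝ :=
  Matrix.fromBlocks (ak • (1 : Matrix ι ι ℝ)) 0 0 aτ

/-- `Q_{k,Ω}φ = ([Q_1φ]_{δΩ_1}, …, [Q_kφ]_{Ω_k})` split the same way: the rows `Q_k` landing in `Ω^{(k)}_{k+1}` and the
rows `Q_τ` landing in the layers. [cite: Dimock2013BalabanII, §2.1 (sunshine0) L466–470 (arXiv:1212.5562v2 TeX)] -/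
def rowsO (Qk : Matrix ι κ ℝ) (Qτ : Matrix τ κ ℝ) : Matrix (ι ⊕ τ) κ ℝ := Matrix.fromRows Qk Qτ

/-- `E := [Q_{k,Ω}ᵀ 𝐚 Q_{k,Ω}]_{Ω_{k+1}ᶜ} = Q_τᵀ 𝐚_τ Q_τ`, the operator of `½‖𝐚^{1/2}Q_{k,Ω}φ‖²_{Ω_{k+1}ᶜ}`.
[cite: Dimock2013BalabanII, App. C L6597–6600 and L6625 (arXiv:1212.5562v2 TeX)] -/
def restE (aτ : Matrix τ τ ℝ) (Qτ : Matrix τ κ ℝ) : Matrix κ κ ℝ := Qτᵀ * aτ * Qτ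

variable {D : Matrix κ κ ℝ} {ak : ℝ} {aτ : Matrix τ τ ℝ} {Qk : Matrix ι κ ℝ} {Qτ : Matrix τ κ ℝ}

omit [Fintype κ] [DecidableEq κ] in
/-- `Q_{k,Ω}ᵀ 𝐚 Q_{k,Ω} = a_k Q_kᵀQ_k + [Q_{k,Ω}ᵀ𝐚Q_{k,Ω}]_{Ω_{k+1}ᶜ}` (the split used at L6657 and L6661).
[cite: Dimock2013BalabanII, App. C L6652–6661 (arXiv:1212.5562v2 TeX)] -/
theorem rowsO_weight_rowsO (ak : ℝ) (aτ : Matrix τ τ ℝ) (Qk : Matrix ι κ ℝ) (Qτ : Matrix τ κ ℝ) :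
    (rowsO Qk Qτ)ᵀ * weightO (ι := ι) ak aτ * rowsO Qk Qτ = ak • (Qkᵀ * Qk) + restE aτ Qτ := by
  unfold rowsO weightO restE
  rw [transpose_fromRows, fromCols_mul_fromBlocks, fromCols_mul_fromRows]
  simp only [Matrix.mul_zero, add_zero, zero_add, Matrix.mul_smul, Matrix.mul_one, Matrix.smul_mul]

omit [Fintype κ] [DecidableEq κ] in
/-- the bracket of `G_{k,Ω}` in the split: `[−Δ + μ̄_k + Q_{k,Ω}ᵀ𝐚Q_{k,Ω}]_{Ω₁} = (D + E) + a_kQ_kᵀQ_k`.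
[cite: Dimock2013BalabanII, App. C L6652–6661 (arXiv:1212.5562v2 TeX)] -/
theorem gInvO_block : gInvO D (weightO ak aτ) (rowsO Qk Qτ) = (D + restE aτ Qτ) + ak • (Qkᵀ * Qk) := by
  unfold gInvO
  rw [Matrix.mul_assoc, ← Matrix.mul_assoc (rowsO Qk Qτ)ᵀ, rowsO_weight_rowsO]
  abel

/-- hence `G_{k,Ω} = G_k` of [Dimock2013] §2.2 with `D ↦ D + E` (`FluctuationCovarianceIdentity.Gk`).
[cite: Dimock2013BalabanII, Thm 2.1 (sinsin) L610–613; App. C L6652–6661 (arXiv:1212.5562v2 TeX)] -/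
theorem GkO_block : GkO D (weightO ak aτ) (rowsO Qk Qτ) = Gk (D + restE aτ Qτ) Qk ak := by
  unfold GkO Gk
  rw [gInvO_block]

/-- **`[Δ_{k,Ω}]_{Ω_{k+1}} = a_k − a_k² Q_k G_{k,Ω} Q_kᵀ`** — the `Ω_{k+1}`-block of the multi-region `Δ_{k,Ω}` is the
single-region closed form (spiffy) of [Dimock2013] with `D ↦ D + E` (`FluctuationCovarianceIdentity.Deltak`).
[cite: Dimock2013BalabanII, Lemma 2.2 L678–680 and App. C (gumdrop2) L6618–6628 (arXiv:1212.5562v2 TeX)] -/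
theorem DeltakO_toBlocks₁₁ :
    (DeltakO D (weightO ak aτ) (rowsO Qk Qτ)).toBlocks₁₁ = Deltak (D + restE aτ Qτ) Qk ak := by
  unfold DeltakO
  rw [GkO_block]
  unfold weightO rowsO Deltak
  rw [transpose_fromRows, fromBlocks_mul_fromRows, fromRows_mul, fromRows_mul_fromCols, fromBlocks_multiply,
    sub_eq_add_neg, fromBlocks_neg, fromBlocks_add, toBlocks_fromBlocks₁₁]
  simp only [Matrix.zero_mul, add_zero, Matrix.mul_zero, Matrix.smul_mul, Matrix.one_mul, Matrix.mul_smul,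
    Matrix.mul_one, smul_smul, ← pow_two, ← sub_eq_add_neg]

omit [DecidableEq ι] in
/-- *"Specializing to Φ_{k,Ω} = (0, Φ) with Φ on Ω_{k+1}"*: the quadratic form of any operator on the multiscale
variables at a vector supported in `Ω_{k+1}` is that of its `Ω_{k+1}`-block.
[cite: Dimock2013BalabanII, App. C L6618–6622 (arXiv:1212.5562v2 TeX)] -/
theorem sumElim_zero_dot_mulVec (M : Matrix (ι ⊕ τ) (ι ⊕ τ) ℝ) (Φ : ι → ℝ) :
    Sum.elim Φ 0 ⬝ᵥ (M *ᵥ Sum.elim Φ 0) = Φ ⬝ᵥ (M.toBlocks₁₁ *ᵥ Φ) := by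
  conv_lhs => rw [← Matrix.fromBlocks_toBlocks M, fromBlocks_mulVec]
  simp only [Sum.elim_comp_inl, Sum.elim_comp_inr, mulVec_zero, add_zero, sumElim_dotProduct_sumElim,
    zero_dotProduct]

/-- … so `⟨(Φ, 0), Δ_{k,Ω}(Φ, 0)⟩ = ⟨Φ, Δ_k[D + E] Φ⟩`: the left side of (gumdrop2) is the single-region Gaussian form
at `D + E`. [cite: Dimock2013BalabanII, App. C (gumdrop2) L6618–6628 (arXiv:1212.5562v2 TeX)] -/
theorem sumElim_zero_dot_DeltakO_mulVec (Φ : ι → ℝ) :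
    Sum.elim Φ 0 ⬝ᵥ (DeltakO D (weightO ak aτ) (rowsO Qk Qτ) *ᵥ Sum.elim Φ 0)
      = Φ ⬝ᵥ (Deltak (D + restE aτ Qτ) Qk ak *ᵥ Φ) := by
  rw [sumElim_zero_dot_mulVec, DeltakO_toBlocks₁₁]

omit [DecidableEq κ] in
/-- `E = Q_τᵀ𝐚_τQ_τ ≥ 0` for `𝐚_τ ≥ 0`. [folklore] -/
private theorem restE_posSemidef (haτ : aτ.PosSemidef) (Qτ : Matrix τ κ ℝ) :
    (restE aτ Qτ).PosSemidef :=
  sandwich_posSemidef haτ Qτ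

/-- the split weight is positive semidefinite for `a_k ≥ 0`, `𝐚_τ ≥ 0`. [folklore] -/
private theorem weightO_posSemidef (hak : 0 ≤ ak) (haτ : aτ.PosSemidef) :
    (weightO (ι := ι) ak aτ).PosSemidef := by
  have hH : (weightO (ι := ι) ak aτ).IsHermitian := by
    unfold weightO
    refine Matrix.IsHermitian.fromBlocks ?_ (by simp) haτ.isHermitian
    rw [IsHermitian, conjTranspose_smul, star_trivial, conjTranspose_one]
  refine PosSemidef.of_dotProduct_mulVec_nonneg hH fun x => ?_
  rw [star_trivial]
  unfold weightO
  conv_rhs => rw [← Sum.elim_comp_inl_inr x, fromBlocks_mulVec]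
  simp only [Sum.elim_comp_inl, Sum.elim_comp_inr, zero_mulVec, add_zero, zero_add, sumElim_dotProduct_sumElim,
    smul_mulVec, one_mulVec, dotProduct_smul, smul_eq_mul]
  have h1 : 0 ≤ (x ∘ Sum.inl) ⬝ᵥ (x ∘ Sum.inl) := Finset.sum_nonneg fun i _ => mul_self_nonneg _
  have h2 : 0 ≤ (x ∘ Sum.inr) ⬝ᵥ (aτ *ᵥ (x ∘ Sum.inr)) := by
    have := haτ.dotProduct_mulVec_nonneg (x ∘ Sum.inr)
    rwa [star_trivial] at this
  exact add_nonneg (mul_nonneg hak h1) h2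

/-! ## §5 App. C, Lemma (z4): the multi-region fluctuation-covariance identity -/

variable {σ : Type*} [Fintype σ] [DecidableEq σ] {Q : Matrix σ ι ℝ} {aL r : ℝ}

/-- `C_{k,Ω⁺,r} = [Δ_{k,Ω} + (a/L²)QᵀQ + r]^{−1}_{Ω_{k+1}}` — the inverse of the `Ω_{k+1}`-block (`aL := a/L²`; the next
averaging `Q` acts on `Ω^{(k)}_{k+1}`). [cite: Dimock2013BalabanII, App. C L6578–6581 (arXiv:1212.5562v2 TeX)] -/
noncomputable def CkOr (D : Matrix κ κ ℝ) (ak : ℝ) (aτ : Matrix τ τ ℝ) (Qk : Matrix ι κ ℝ) (Qτ : Matrix τ κ ℝ)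
    (Q : Matrix σ ι ℝ) (aL r : ℝ) : Matrix ι ι ℝ :=
  ((DeltakO D (weightO ak aτ) (rowsO Qk Qτ)).toBlocks₁₁ + aL • proj Q + r • (1 : Matrix ι ι ℝ))⁻¹

/-- `G_{k,Ω⁺,r} = [−Δ + μ̄_k + [Q_{k,Ω}ᵀ𝐚Q_{k,Ω}]_{Ω_{k+1}ᶜ} + a_k[Q_kᵀB_{k,r}Q_k]_{Ω_{k+1}}]_{Ω₁}^{−1}`.
[cite: Dimock2013BalabanII, App. C Lemma (z4) L6592–6599 (arXiv:1212.5562v2 TeX)] -/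
noncomputable def GkOr (D : Matrix κ κ ℝ) (ak : ℝ) (aτ : Matrix τ τ ℝ) (Qk : Matrix ι κ ℝ) (Qτ : Matrix τ κ ℝ)
    (Q : Matrix σ ι ℝ) (aL r : ℝ) : Matrix κ κ ℝ :=
  (D + restE aτ Qτ + ak • (Qkᵀ * Bkr Q ak aL r * Qk))⁻¹

omit [DecidableEq σ] in
/-- `C_{k,Ω⁺,r}` is the single-region `C_{k,r}` of [Dimock2013] App. C at `D + E`.
[cite: Dimock2013BalabanII, App. C L6578–6581 and (gumdrop2) L6618–6628 (arXiv:1212.5562v2 TeX)] -/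
theorem CkOr_eq_Ckr : CkOr D ak aτ Qk Qτ Q aL r = Ckr (D + restE aτ Qτ) Qk Q ak aL r := by
  unfold CkOr Ckr
  rw [DeltakO_toBlocks₁₁]

omit [DecidableEq σ] in
/-- `G_{k,Ω⁺,r}` is the single-region `G_{k,r}` at `D + E` (insert `1 − a_kA_{k,r} = B_{k,r}`,
`FluctuationCovarianceIdentity.gkrInv_eq`). [cite: Dimock2013BalabanII, App. C L6657–6688 (arXiv:1212.5562v2 TeX)] -/
theorem GkOr_eq_Gkr (h1 : ak + r ≠ 0) (h2 : ak + aL + r ≠ 0) :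
    GkOr D ak aτ Qk Qτ Q aL r = Gkr (D + restE aτ Qτ) Qk Q ak aL r := by
  unfold GkOr Gkr
  rw [gkrInv_eq h1 h2]

/-- **LEMMA (z4)** (App. C of [Dimock2013BalabanII]): for `D = [−Δ + μ̄_k]_{Ω₁}` positive definite, `𝐚_τ ≥ 0`,
`QQᵀ = I`, `a_k > 0`, `aL = a/L² ≥ 0`, `r ≥ 0`:
`C_{k,Ω⁺,r} = A_{k,r} + a_k² A_{k,r} Q_k G_{k,Ω⁺,r} Q_kᵀ A_{k,r}` (on `Ω^{(k)}_{k+1}`).  Proof: the Gaussian integrals of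
L6604–6681 are the Woodbury identity `FluctuationCovarianceIdentity.Ckr_eq` at `D + E`.
[cite: Dimock2013BalabanII, App. C Lemma (z4) L6586–6601 (arXiv:1212.5562v2 TeX)] -/
theorem CkOr_eq (hD : D.PosDef) (haτ : aτ.PosSemidef) (hQ : Q * Qᵀ = 1) (hak : 0 < ak) (haL : 0 ≤ aL)
    (hr : 0 ≤ r) :
    CkOr D ak aτ Qk Qτ Q aL r
      = Akr Q ak aL r + ak ^ 2 • (Akr Q ak aL r * Qk * GkOr D ak aτ Qk Qτ Q aL r * Qkᵀ * Akr Q ak aL r) := by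
  rw [CkOr_eq_Ckr, GkOr_eq_Gkr (by linarith) (by linarith)]
  exact Ckr_eq (hD.add_posSemidef (restE_posSemidef haτ Qτ)) hQ hak haL hr

/-- under the same hypotheses `[Δ_{k,Ω} + aL·QᵀQ + r]_{Ω_{k+1}}` is invertible and `C_{k,Ω⁺,r}` is its inverse (not a
junk value). [cite: Dimock2013BalabanII, App. C L6578–6581 (arXiv:1212.5562v2 TeX)] -/
theorem CkOr_mul_eq_one (hD : D.PosDef) (haτ : aτ.PosSemidef) (hQ : Q * Qᵀ = 1) (hak : 0 < ak) (haL : 0 ≤ aL)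
    (hr : 0 ≤ r) :
    CkOr D ak aτ Qk Qτ Q aL r
        * ((DeltakO D (weightO ak aτ) (rowsO Qk Qτ)).toBlocks₁₁ + aL • proj Q + r • (1 : Matrix ι ι ℝ)) = 1 := by
  rw [CkOr_eq_Ckr, DeltakO_toBlocks₁₁]
  exact (Ckr_mul_eq_one_and_eq (hD.add_posSemidef (restE_posSemidef haτ Qτ)) hQ hak haL hr).1

/-- and the `Ω_{k+1}`-block `[Δ_{k,Ω}]_{Ω_{k+1}}` is itself positive definite (`CovarianceSquareRoot.Deltak_posDef` at
`D + E`), so `[Δ_{k,Ω} + aL·QᵀQ]_{Ω_{k+1}}` is a genuine Gaussian form in `Z` ((sweet3) L893–916).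
[cite: Dimock2013BalabanII, §2.3 L893–916 and App. C L6578–6581 (arXiv:1212.5562v2 TeX)] -/
theorem DeltakO_toBlocks₁₁_posDef (hD : D.PosDef) (haτ : aτ.PosSemidef) (hak : 0 < ak) :
    ((DeltakO D (weightO ak aτ) (rowsO Qk Qτ)).toBlocks₁₁).PosDef := by
  rw [DeltakO_toBlocks₁₁]
  exact Deltak_posDef (hD.add_posSemidef (restE_posSemidef haτ Qτ)) hak

/-! ## §6 [Dimock2013BalabanIII] App. A, Lemma 18: the joint minimizer in `(Φ_{k,Ω_{k+1}}, φ_{Ω₁})` -/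

omit [Fintype ι] [Fintype τ] [DecidableEq ι] in
/-- componentwise subtraction of split vectors. [folklore] -/
private theorem sumElim_sub (u u' : ι → ℝ) (v v' : τ → ℝ) :
    Sum.elim u v - Sum.elim u' v' = Sum.elim (u - u') (v - v') := by
  ext (i | i) <;> rfl

omit [DecidableEq κ] in
/-- **the action separates along the split**: `S(Ω₁, (Φ_{k,Ω_{k+1}}, Φ_{k,δΩ⁺}), φ) = (a_k/2)‖Φ_{k,Ω_{k+1}} − Q_kφ‖² +
S_δ(Φ_{k,δΩ⁺}, φ)` where `S_δ` is the action (box2) built on `Q_{k,δΩ⁺}`, `𝐚_τ` alone.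
[cite: Dimock2013BalabanIII, App. A (box1)–(box2) L2516–2532 (arXiv:1304.0705v1 TeX)] -/
theorem action_block (Φι : ι → ℝ) (Φτ : τ → ℝ) (φ : κ → ℝ) :
    action D (weightO ak aτ) (rowsO Qk Qτ) (Sum.elim Φι Φτ) φ
      = (ak / 2) * ((Φι - Qk *ᵥ φ) ⬝ᵥ (Φι - Qk *ᵥ φ)) + action D aτ Qτ Φτ φ := by
  unfold action weightO rowsO
  rw [fromRows_mulVec, sumElim_sub, fromBlocks_mulVec]
  simp only [Sum.elim_comp_inl, Sum.elim_comp_inr, zero_mulVec, add_zero, zero_add, sumElim_dotProduct_sumElim,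
    smul_mulVec, one_mulVec, dotProduct_smul, smul_eq_mul]
  ring

omit [DecidableEq κ] in
/-- … and so does the exponent: `E((Φ_{k,Ω_{k+1}}, Φ_{k,δΩ⁺}), φ) = (a_k/2)‖Φ_{k,Ω_{k+1}} − Q_kφ‖² + E_δ(Φ_{k,δΩ⁺}, φ)`.
[cite: Dimock2013BalabanIII, App. A (box1)–(box2) L2516–2532 (arXiv:1304.0705v1 TeX)] -/
theorem energy_block (Φι : ι → ℝ) (Φτ : τ → ℝ) (src φ : κ → ℝ) :
    energy D (weightO ak aτ) (rowsO Qk Qτ) (Sum.elim Φι Φτ) src φ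
      = (ak / 2) * ((Φι - Qk *ᵥ φ) ⬝ᵥ (Φι - Qk *ᵥ φ)) + energy D aτ Qτ Φτ src φ := by
  unfold energy
  rw [action_block]
  ring

/-- **LEMMA 18, part 1 (star) — the joint minimum**: with `φ_{k,δΩ⁺} = G_{k,δΩ⁺}(Q_{k,δΩ⁺}ᵀ𝐚Φ_{k,δΩ⁺} +
[Δ]_{Ω₁,Ω₁ᶜ}φ_{Ω₁ᶜ})` (= `minimizer D 𝐚_τ Q_τ Φ_τ src`) and `Ψ_{k,Ω_{k+1}} = Q_kφ_{k,δΩ⁺}`, the exponent at `(Ψ, φ_{k,δΩ⁺})`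
is `≤` its value at every `(Φ_{k,Ω_{k+1}}, φ_{Ω₁})` (`a_k ≥ 0`, `𝐚_τ ≥ 0`, `D > 0`).
[cite: Dimock2013BalabanIII, App. A Lemma 18 (star) L2551–2564, proof L2579–2592 (arXiv:1304.0705v1 TeX)] -/
theorem energy_block_joint_min (hD : D.PosDef) (haτ : aτ.PosSemidef) (hak : 0 ≤ ak) (Φτ : τ → ℝ) (src : κ → ℝ)
    (Φι : ι → ℝ) (φ : κ → ℝ) :
    energy D (weightO ak aτ) (rowsO Qk Qτ) (Sum.elim (Qk *ᵥ minimizer D aτ Qτ Φτ src) Φτ) src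
        (minimizer D aτ Qτ Φτ src)
      ≤ energy D (weightO ak aτ) (rowsO Qk Qτ) (Sum.elim Φι Φτ) src φ := by
  rw [energy_block, energy_block, sub_self, zero_dotProduct, mul_zero, zero_add]
  have h1 : 0 ≤ (Φι - Qk *ᵥ φ) ⬝ᵥ (Φι - Qk *ᵥ φ) := Finset.sum_nonneg fun i _ => mul_self_nonneg _
  have h2 := energy_minimizer_le (Qm := Qτ) hD haτ Φτ src φ
  nlinarith [mul_nonneg hak h1]

/-- **LEMMA 18, part 1 (star) — uniqueness** (*"the unique minimum … comes at φ_{Ω₁} = φ_{k,δΩ⁺} … and at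
Φ_{k,Ω_{k+1}} = Ψ_{k,Ω_{k+1}} = Q_kφ_{k,δΩ⁺}"*): the minimum value is attained at `(Φ_{k,Ω_{k+1}}, φ)` iff
`φ = φ_{k,δΩ⁺}` and `Φ_{k,Ω_{k+1}} = Q_kφ` (`a_k > 0`).
[cite: Dimock2013BalabanIII, App. A Lemma 18 (star) L2551–2564, proof L2579–2592 (arXiv:1304.0705v1 TeX)] -/
theorem energy_block_eq_joint_min_iff (hD : D.PosDef) (haτ : aτ.PosSemidef) (hak : 0 < ak) (Φτ : τ → ℝ)
    (src : κ → ℝ) (Φι : ι → ℝ) (φ : κ → ℝ) :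
    energy D (weightO ak aτ) (rowsO Qk Qτ) (Sum.elim Φι Φτ) src φ
        = energy D (weightO ak aτ) (rowsO Qk Qτ) (Sum.elim (Qk *ᵥ minimizer D aτ Qτ Φτ src) Φτ) src
          (minimizer D aτ Qτ Φτ src)
      ↔ φ = minimizer D aτ Qτ Φτ src ∧ Φι = Qk *ᵥ φ := by
  constructor
  · intro h
    rw [energy_block, energy_block, sub_self, zero_dotProduct, mul_zero, zero_add] at h
    have h1 : 0 ≤ (Φι - Qk *ᵥ φ) ⬝ᵥ (Φι - Qk *ᵥ φ) := Finset.sum_nonneg fun i _ => mul_self_nonneg _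
    have h2 := energy_minimizer_le (Qm := Qτ) hD haτ Φτ src φ
    have hφ : φ = minimizer D aτ Qτ Φτ src := by
      by_contra hne
      have h3 := energy_minimizer_lt (Qm := Qτ) hD haτ Φτ src hne
      nlinarith [mul_nonneg hak.le h1]
    refine ⟨hφ, ?_⟩
    have h4 : ak / 2 * ((Φι - Qk *ᵥ φ) ⬝ᵥ (Φι - Qk *ᵥ φ)) = 0 := by
      rw [← hφ] at h
      linarith
    have h5 : (Φι - Qk *ᵥ φ) ⬝ᵥ (Φι - Qk *ᵥ φ) = 0 :=
      (mul_eq_zero.mp h4).resolve_left (by positivity)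
    exact sub_eq_zero.mp (dotProduct_self_eq_zero.mp h5)
  · rintro ⟨hφ, hΦ⟩
    rw [hΦ, hφ]

/-- **LEMMA 18, part 2 (star2)**: `φ_{k,δΩ⁺} = φ_{k,Ω}(φ_{Ω₁ᶜ}, Φ_{k,δΩ⁺}, Ψ_{k,Ω_{k+1}}(δΩ⁺))` — the `δΩ⁺`-minimizer is
the full multi-region minimizer (unknown) evaluated at `Φ_{k,Ω_{k+1}} = Ψ` (*"Substituting Φ_{k,Ω_{k+1}} = Q_kφ into the
second equation and canceling a term a_kQ_kᵀQ_kφ on each side"*).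
[cite: Dimock2013BalabanIII, App. A Lemma 18 (star2) L2565–2570, proof L2595–2600 (arXiv:1304.0705v1 TeX)] -/
theorem minimizer_star2 (hD : D.PosDef) (haτ : aτ.PosSemidef) (hak : 0 ≤ ak) (Φτ : τ → ℝ) (src : κ → ℝ) :
    minimizer D (weightO ak aτ) (rowsO Qk Qτ) (Sum.elim (Qk *ᵥ minimizer D aτ Qτ Φτ src) Φτ) src
      = minimizer D aτ Qτ Φτ src := by
  symm
  apply eq_minimizer_of_variational_eq hD (weightO_posSemidef hak haτ)
  have hτ : gInvO D aτ Qτ *ᵥ minimizer D aτ Qτ Φτ src = Qτᵀ *ᵥ (aτ *ᵥ Φτ) + src := variational_eq hD haτ Φτ src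
  rw [gInvO_block, add_mulVec]
  unfold weightO rowsO
  rw [transpose_fromRows, fromBlocks_mulVec, fromCols_mulVec_sumElim]
  simp only [Sum.elim_comp_inl, Sum.elim_comp_inr, zero_mulVec, add_zero, zero_add, smul_mulVec, one_mulVec,
    mulVec_smul]
  unfold gInvO restE at *
  rw [hτ, ← mulVec_mulVec]
  abel

end Block

/-! ## §7 Non-vacuity: one-site instances of every hypothesis -/

/-- Lemma 2.2 on one site per lattice: `D = 𝐚 = Q_{k,Ω} = 1`; then `G = ½`, `φ_{k,Ω} = ½(Φ + src)`,
`Δ_{k,Ω} = ½`, and (rain) reads `S = ¼Φ² + ¼src²` — an instance of `action_minimizer`. -/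
example (Φ src : Unit → ℝ) :
    action (1 : Matrix Unit Unit ℝ) (1 : Matrix Unit Unit ℝ) (1 : Matrix Unit Unit ℝ) Φ
        (minimizer (1 : Matrix Unit Unit ℝ) 1 1 Φ src)
      = (1 / 2) * (Φ ⬝ᵥ (DeltakO (1 : Matrix Unit Unit ℝ) (1 : Matrix Unit Unit ℝ) 1 *ᵥ Φ))
        + (1 / 2) * (src ⬝ᵥ (GkO (1 : Matrix Unit Unit ℝ) (1 : Matrix Unit Unit ℝ) 1 *ᵥ src)) :=
  action_minimizer Matrix.PosDef.one Matrix.PosSemidef.one Φ src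

/-- (z4) on one site per lattice: `D = 𝐚_τ = 1`, `Q_k = Q_τ = Q = 1`, `a_k = 1`, `aL = r = 0` — every hypothesis of
`CkOr_eq` is met (here `E = 1`, `Δ_k[D + E] = 1 − 1/3 = 2/3`, `C = 3/2 = A + AQ_kGQ_kᵀA` with `A = 1`, `B = 0`, `G = ½`). -/
example : CkOr (1 : Matrix Unit Unit ℝ) 1 (1 : Matrix Unit Unit ℝ) (1 : Matrix Unit Unit ℝ)
      (1 : Matrix Unit Unit ℝ) (1 : Matrix Unit Unit ℝ) 0 0
    = Akr (1 : Matrix Unit Unit ℝ) 1 0 0 + (1 : ℝ) ^ 2 • (Akr (1 : Matrix Unit Unit ℝ) 1 0 0 * 1 *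
        GkOr (1 : Matrix Unit Unit ℝ) 1 (1 : Matrix Unit Unit ℝ) (1 : Matrix Unit Unit ℝ) (1 : Matrix Unit Unit ℝ)
          (1 : Matrix Unit Unit ℝ) 0 0 * (1 : Matrix Unit Unit ℝ)ᵀ * Akr (1 : Matrix Unit Unit ℝ) 1 0 0) :=
  CkOr_eq Matrix.PosDef.one Matrix.PosSemidef.one (by simp) one_pos le_rfl le_rfl

/-- Lemma 18 (star2) on one site per lattice. -/
example (Φτ src : Unit → ℝ) :
    minimizer (1 : Matrix Unit Unit ℝ) (weightO 1 (1 : Matrix Unit Unit ℝ))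
        (rowsO (1 : Matrix Unit Unit ℝ) (1 : Matrix Unit Unit ℝ))
        (Sum.elim ((1 : Matrix Unit Unit ℝ) *ᵥ minimizer (1 : Matrix Unit Unit ℝ) 1 1 Φτ src) Φτ) src
      = minimizer (1 : Matrix Unit Unit ℝ) 1 1 Φτ src :=
  minimizer_star2 Matrix.PosDef.one Matrix.PosSemidef.one zero_le_one Φτ src

end Literature.MathematicalPhysics.QuantumFieldTheory.Dimock2011to13.MultiRegionFreeFlow
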